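/-
Origin: expansion seat `literature-prover-pub-hodgecm-cf-kudla-howe-rallis-g2-0`, handover #2 2026-08-18T04:59:42Z (`HOME/pub-hodgecm-cf-kudla-howe-rallis-g2/MetaplecticDirectSum.lean`, md5 720ec252, 207 lines);
landed by the gen-6 packager in gate run 22 as `HodgeCM/Literature/MetaplecticDirectSum.lean` (verbatim).
-/
/-
Origin: HOME/pub-hodgecm-cf-kudla-howe-rallis-g2/MetaplecticDirectSum.lean — session
literature-prover-pub-hodgecm-cf-kudla-howe-rallis-g2-0 (unit pub-hodgecm-cf-kudla-howe-rallis-g2, CITED-FACT seat (4) gen 2).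
Intended place: `HodgeCM/Literature/MetaplecticDirectSum.lean` (imports `Mathlib` only).  Companion prose:
HOME/CITED-FACTS.md § pub-hodgecm-cf-kudla-howe-rallis-g2 (KHR-18), HOME/GAPS.md cfKHR-G1 / cfKHRg2-G1.
-/
import Mathlib

set_option autoImplicit false

/-!
# The Weil representation on an orthogonal direct sum: Rao's standard model is a tensor product
# (Ranga Rao 1993, Prop. 3.7 / Thm 4.1 (3)) — the print input behind "Kudla's splitting is multiplicative in
# orthogonal sums" (PerL v5 Lemma 3.4, tex l. 334; node N17; LEMMAS §10 residue "[Ku94 §1]")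

Typing discipline as in `HodgeCM/Literature/ThetaCorrespondence.lean`: the printed theorem is a
`def … : Prop` over a structure of BARE CARRIERS; nothing is asserted.  The kernel part of this file is
Kudla's / MVW's realisation of the metaplectic group of `W₁ ⊕ W₂` on `S₁ ⊗ S₂` ("Réalisons la représentation
métaplectique de `H(W,<,>)` dans `S = S₁ ⊗ S₂`", [MVW, Chap. 2, II.1, Rem. (6)]; [Ku96, Chap. I, (**)]:
`j̃((g₁, A(g₁)), (g₂, A(g₂))) = (j(g₁,g₂), A(g₁) ⊗ A(g₂))`) in the OPERATOR MODEL of the metaplectic group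
([HKS96, (1.12)]: "`Mp(𝕎) ≃ Sp(𝕎) × ℂ¹` as sets … the multiplication … described by the cocycle `c_Y`", i.e.
`(g, z) ↦` the operator `z · r(g)`, `r` Rao's standard model): on operators, `j̃(A₁, A₂) = e ∘ (A₁ ⊗ A₂) ∘ e⁻¹`
is a homomorphism by functoriality of `⊗` (`jOp` below, kernel), and Rao's Prop. 3.7 says precisely that it
carries `(z₁ r₁(σ₁), z₂ r₂(σ₂))` to `z₁z₂ · r(diag(σ₁, σ₂))` (`jOp_scale_r`, kernel from the typed Prop).
The consumer is `HodgeCM/Automorphic/SeesawSplittingModel.lean` (the `G_U`-side compatibility of the HKS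
splittings at the doubled level, and its descent).

Source (OPEN ACCESS, cell-readable): R. Ranga Rao, *On some explicit formulas in the theory of Weil
representation*, Pacific J. Math. 157 (1993) 335–371, doi:10.2140/pjm.1993.157.335 — held as text
(`paper:doi-10-2140-pjm-1993-157-335`); the displayed formulas, dropped by the OCR of the scanned PDF, were
read on page images rendered from the scan (`HOME/pub-hodgecm-cf-kudla-howe-rallis-g2/lit/Rao93/rao93_p356–
p358.png`).  Companions: [HKS96] Harris–Kudla–Sweet, J. Amer. Math. Soc. 9 (1996), (1.12)–(1.13) p. 952 (the
same coordinates: "`c_Y(g₁, g₂) = γ_F(η ∘ L(Y, Yg₂⁻¹, Yg₁))`" = Rao's Thm 4.1 (5)); [MVW] Mœglin–Vignéras–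
Waldspurger, LNM 1291, Chap. 2 II.1 Rem. (6) (quoted in `ThetaCorrespondence.lean` §6a); [Ku96] Kudla, Castle
notes, Chap. I (**) and Thm 3.1.
-/

noncomputable section

open scoped TensorProduct

universe u

namespace HodgeCM.Literature.Theta

/-- **Carriers for [Rao93, §3 pp. 350–358 and §4 p. 358]**: `F` a local field of characteristic `≠ 2` with a
non-trivial character `χ`; `X = V + V*` a symplectic space with symplectic basis `e₁, …, e_n, e₁*, …, e_n*`;
a partition `{1, …, n} = S₁ ⊔ S₂` (Rao: `S₁, …, S_m`; two blocks suffice for every use here), so that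
`X = X_{S₁} ⊕ X_{S₂}`, `X_S = V_S + V_S*`, is an ORTHOGONAL direct sum of symplectic spaces with compatible
polarisations;
* `Sp₁`, `Sp₂`, `Sp` — `Sp(X_{S₁})`, `Sp(X_{S₂})`, `Sp(X)`, with `diag (σ₁, σ₂) = diag(σ₁, σ₂)` the
  block-diagonal embedding (a homomorphism);
* `T₁`, `T₂`, `T` — the spaces `L²(V_{S₁})`, `L²(V_{S₂})`, `L²(V)` (equally: the Schwartz spaces) carrying the
  standard models, with the identification `e : T₁ ⊗ T₂ ≃ T` of functions on `V = V_{S₁} ⊕ V_{S₂}` (p. 356: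
  "the Fourier transform operator on `V` is the tensor product of those corresponding to `V₁`, `V₂`, when
  `V = V₁ + V₂`");
* `r₁`, `r₂`, `r` — Rao's standard Segal–Shale–Weil (projective) representations `r_{S₁}`, `r_{S₂}`, `r`
  (Def. 3.6, p. 357: "The map `σ → r(σ)` is called the standard Segal-Shale-Weil (projective)
  representation. Note its construction depends only on the character `χ` of `F` and the symplectic basis
  `e₁, …, e_n*` of `X`"), by unitary — in particular invertible — operators ((3.12), Thm 3.5). -/
structure RaoDirectSumDatum where
  /-- `Sp(X_{S₁})` -/
  Sp₁ : Type u
  /-- `Sp(X_{S₂})` -/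
  Sp₂ : Type u
  /-- `Sp(X)` -/
  Sp : Type u
  [instG₁ : Group Sp₁]
  [instG₂ : Group Sp₂]
  [instG : Group Sp]
  /-- `(σ₁, σ₂) ↦ diag(σ₁, σ₂)` -/
  diag : Sp₁ × Sp₂ →* Sp
  /-- `L²(V_{S₁})` -/
  T₁ : Type u
  /-- `L²(V_{S₂})` -/
  T₂ : Type u
  /-- `L²(V)` -/
  T : Type u
  [instT₁ : AddCommGroup T₁] [instM₁ : Module ℂ T₁]
  [instT₂ : AddCommGroup T₂] [instM₂ : Module ℂ T₂]
  [instT : AddCommGroup T] [instM : Module ℂ T]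
  /-- `L²(V_{S₁}) ⊗ L²(V_{S₂}) ≃ L²(V)` -/
  e : T₁ ⊗[ℂ] T₂ ≃ₗ[ℂ] T
  /-- `r_{S₁}` -/
  r₁ : Sp₁ → (T₁ ≃ₗ[ℂ] T₁)
  /-- `r_{S₂}` -/
  r₂ : Sp₂ → (T₂ ≃ₗ[ℂ] T₂)
  /-- `r` -/
  r : Sp → (T ≃ₗ[ℂ] T)

attribute [instance] RaoDirectSumDatum.instG₁ RaoDirectSumDatum.instG₂ RaoDirectSumDatum.instG
  RaoDirectSumDatum.instT₁ RaoDirectSumDatum.instM₁ RaoDirectSumDatum.instT₂ RaoDirectSumDatum.instM₂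
  RaoDirectSumDatum.instT RaoDirectSumDatum.instM

namespace RaoDirectSumDatum

variable (D : RaoDirectSumDatum.{u})

/-- **The standard model on an orthogonal direct sum is the tensor product (Ranga Rao).**  AS PRINTED
[Rao93, **Proposition 3.7**, p. 357 (page image `lit/Rao93/rao93_p357.png`)]: "For any arbitrary subset `S`
of `{1, 2, …, n}` let `r_S(·)` denote the standard Weil representation of `Sp(X)` corresponding to the data
`X_S = V_S + V_S*`, the symplectic basis being `{e_j, e_j*, j ∈ S}`.  Let `S₁, …, S_m` be a partition of
`{1, 2, …, n}` and let `σ_j ∈ Sp(X)`, `j = 1, 2, …, m`.  If `σ = diag(σ₁, …, σ_m) ∈ Sp(X)` then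
`r(σ) = r_{S₁}(σ₁) ⊗ ⋯ ⊗ r_{S_m}(σ_m)`."  Preceded by (p. 357): "Good behaviour of the Weil representation
for direct sums of symplectic vector spaces has been noted from the beginning.  In terms of the standard
model `σ → r(σ)`, this can be formalized as follows."  Its scalar shadow is [Rao93, **Theorem 4.1 (3)**,
p. 358 (image `rao93_p358.png`)]: with (4.1) "`r(σ₁)r(σ₂) = c(σ₁, σ₂) r(σ₁σ₂)`", "(3) If `S₁, S₂, …, S_m`
is a partition of `{1, 2, …, n}` and `c_S(·, ·)` denotes the multiplier of the standard Weil representation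
`r_S`, then `c(σ, σ') = ∏_j c_{S_j}(σ_j, σ'_j)` where `σ = diag(σ₁, …, σ_m)`, `σ' = diag(σ'₁, …, σ'_m)`";
and (5) "`c(σ₁, σ₂)` = Weil index of `χ(½⟨x, x·ρ⟩)` where the isometry class of `ρ` is given by the Leray
invariant `q(V*, V*σ₂⁻¹, V*σ₁)`" — which is [HKS96, (1.13)] `c_Y(g₁, g₂) = γ_F(η ∘ L(Y, Yg₂⁻¹, Yg₁))`,
`η = ½ψ`, `Y = V*`: the coordinates `Mp ≃ Sp × ℂ¹` of [HKS96, (1.12)] ARE Rao's standard-model coordinates.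
TYPING: `m = 2`; the identity `r(σ) = r_{S₁}(σ₁) ⊗ r_{S₂}(σ₂)` is checked on pure tensors through the
identification `e` (pure tensors generate).  Local (one place); the adelic statement is the restricted
tensor product over places (LEMMAS.md D4), as for every record of `ThetaCorrespondence.lean` §6.
PerL v5 USE: Lemma 3.4 (seesaw), tex l. 333–334 "(Kudla's splitting is multiplicative in orthogonal sums)" —
the `G_U`-side: `G_U = U(V₃)` fixed, partner `W = W₁ ⊕ W₂`, doubled symplectic spaces
`𝕎^□ = 𝕎₁^□ ⊕ 𝕎₂^□` with `𝕐 = 𝕐₁ ⊕ 𝕐₂` (HKS's diagonal Lagrangian tensored with `W₁`, `W₂`); consumer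
`HodgeCM/Automorphic/SeesawSplittingModel.lean`.  MISMATCH: none. -/
def StandardModelTensor : Prop :=
  ∀ (σ₁ : D.Sp₁) (σ₂ : D.Sp₂) (x₁ : D.T₁) (x₂ : D.T₂),
    D.r (D.diag (σ₁, σ₂)) (D.e (x₁ ⊗ₜ[ℂ] x₂)) = D.e (D.r₁ σ₁ x₁ ⊗ₜ[ℂ] D.r₂ σ₂ x₂)

/-! ### Kernel: Kudla's `j̃` in the operator model -/

variable {D}

/-- Two linear maps out of `T` agree as soon as they agree on the images `e(x₁ ⊗ x₂)` of pure tensors. -/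
theorem linearMap_ext_of_tmul {f g : D.T →ₗ[ℂ] D.T}
    (h : ∀ (x₁ : D.T₁) (x₂ : D.T₂), f (D.e (x₁ ⊗ₜ[ℂ] x₂)) = g (D.e (x₁ ⊗ₜ[ℂ] x₂))) : f = g := by
  have hcomp : f.comp D.e.toLinearMap = g.comp D.e.toLinearMap :=
    TensorProduct.ext' fun x₁ x₂ => h x₁ x₂
  ext x
  have hx := congrArg (fun φ : D.T₁ ⊗[ℂ] D.T₂ →ₗ[ℂ] D.T => φ (D.e.symm x)) hcomp
  simpa using hx

/-- Equality of linear automorphisms of `T` from equality on the `e(x₁ ⊗ x₂)`. -/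
theorem linearEquiv_ext_of_tmul {f g : D.T ≃ₗ[ℂ] D.T}
    (h : ∀ (x₁ : D.T₁) (x₂ : D.T₂), f (D.e (x₁ ⊗ₜ[ℂ] x₂)) = g (D.e (x₁ ⊗ₜ[ℂ] x₂))) : f = g :=
  LinearEquiv.toLinearMap_injective (linearMap_ext_of_tmul (f := f.toLinearMap) (g := g.toLinearMap) h)

variable (D)

/-- The operator `e ∘ (A₁ ⊗ A₂) ∘ e⁻¹` on `T` ([Ku96 (**)]: "`A(g₁) ⊗ A(g₂)`" transported to `S`). -/
def jFun (A : (D.T₁ ≃ₗ[ℂ] D.T₁) × (D.T₂ ≃ₗ[ℂ] D.T₂)) : D.T ≃ₗ[ℂ] D.T :=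
  D.e.symm ≪≫ₗ (TensorProduct.congr A.1 A.2 ≪≫ₗ D.e)

/-- (Ported verbatim from the HodgeCMPerL package; no docstring in the source.) -/
@[simp]
theorem jFun_apply_tmul (A : (D.T₁ ≃ₗ[ℂ] D.T₁) × (D.T₂ ≃ₗ[ℂ] D.T₂)) (x₁ : D.T₁) (x₂ : D.T₂) :
    D.jFun A (D.e (x₁ ⊗ₜ[ℂ] x₂)) = D.e (A.1 x₁ ⊗ₜ[ℂ] A.2 x₂) := by
  simp [jFun, LinearEquiv.trans_apply, TensorProduct.congr_tmul]

/-- **Kudla's `j̃ : Mp(𝕎₁) × Mp(𝕎₂) → Mp(𝕎)` in the operator model** — `(A₁, A₂) ↦ e ∘ (A₁ ⊗ A₂) ∘ e⁻¹`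
is a group homomorphism `GL(T₁) × GL(T₂) → GL(T)` (kernel: functoriality of `⊗`).  [MVW, Chap. 2, II.1,
Rem. (6)]: "un homomorphisme `GL(S₁) × GL(S₂) ⟶ GL(S)` de noyau l'ensemble des `(z id_{S₁}, z⁻¹ id_{S₂})`". -/
def jOp : (D.T₁ ≃ₗ[ℂ] D.T₁) × (D.T₂ ≃ₗ[ℂ] D.T₂) →* (D.T ≃ₗ[ℂ] D.T) where
  toFun := D.jFun
  map_one' := by
    refine linearEquiv_ext_of_tmul fun x₁ x₂ => ?_
    rw [jFun_apply_tmul]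
    rfl
  map_mul' A B := by
    refine linearEquiv_ext_of_tmul fun x₁ x₂ => ?_
    rw [jFun_apply_tmul, LinearEquiv.mul_apply, jFun_apply_tmul, jFun_apply_tmul]
    rfl

/-- (Ported verbatim from the HodgeCMPerL package; no docstring in the source.) -/
@[simp]
theorem jOp_apply_tmul (A : (D.T₁ ≃ₗ[ℂ] D.T₁) × (D.T₂ ≃ₗ[ℂ] D.T₂)) (x₁ : D.T₁) (x₂ : D.T₂) :
    D.jOp A (D.e (x₁ ⊗ₜ[ℂ] x₂)) = D.e (A.1 x₁ ⊗ₜ[ℂ] A.2 x₂) :=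
  D.jFun_apply_tmul A x₁ x₂

/-- The scalar operator `z · id` for `z ∈ ℂˣ` (the central `ℂ¹ ⊂ ℂˣ` of [HKS96, (1.12)]). -/
def scale (M : Type u) [AddCommGroup M] [Module ℂ M] (z : ℂˣ) : M ≃ₗ[ℂ] M :=
  LinearEquiv.smulOfUnit z

/-- (Ported verbatim from the HodgeCMPerL package; no docstring in the source.) -/
@[simp]
theorem scale_apply (M : Type u) [AddCommGroup M] [Module ℂ M] (z : ℂˣ) (x : M) :
    scale M z x = (z : ℂ) • x := rfl

/-- The element `(σ, z)` of `Mp ≃ Sp × ℂ¹` [HKS96, (1.12)] as the OPERATOR `z · r(σ)`. -/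
def opOf (σ : D.Sp) (z : ℂˣ) : D.T ≃ₗ[ℂ] D.T := scale D.T z * D.r σ

/-- `(σ₁, z₁) ↦ z₁ · r_{S₁}(σ₁)`. -/
def opOf₁ (σ₁ : D.Sp₁) (z : ℂˣ) : D.T₁ ≃ₗ[ℂ] D.T₁ := scale D.T₁ z * D.r₁ σ₁

/-- `(σ₂, z₂) ↦ z₂ · r_{S₂}(σ₂)`. -/
def opOf₂ (σ₂ : D.Sp₂) (z : ℂˣ) : D.T₂ ≃ₗ[ℂ] D.T₂ := scale D.T₂ z * D.r₂ σ₂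

variable {D}

/-- **Rao's Prop. 3.7 in Kudla's coordinates, kernel-checked:** `j̃((σ₁, z₁), (σ₂, z₂)) =
(diag(σ₁, σ₂), z₁z₂)`, i.e. `e ∘ (z₁ r_{S₁}(σ₁) ⊗ z₂ r_{S₂}(σ₂)) ∘ e⁻¹ = z₁z₂ · r(diag(σ₁, σ₂))` — so the map
`((σ₁, z₁), (σ₂, z₂)) ↦ (diag(σ₁, σ₂), z₁z₂)` of [HKS96, (1.12)]-coordinates IS the homomorphism `jOp`
(whence [Rao93, Thm 4.1 (3)] for the multipliers). -/
theorem StandardModelTensor.jOp_opOf (h : D.StandardModelTensor) (σ₁ : D.Sp₁) (σ₂ : D.Sp₂)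
    (z₁ z₂ : ℂˣ) :
    D.jOp (D.opOf₁ σ₁ z₁, D.opOf₂ σ₂ z₂) = D.opOf (D.diag (σ₁, σ₂)) (z₁ * z₂) := by
  refine linearEquiv_ext_of_tmul fun x₁ x₂ => ?_
  rw [jOp_apply_tmul]
  simp only [opOf, opOf₁, opOf₂, LinearEquiv.mul_apply, scale_apply, h σ₁ σ₂ x₁ x₂]
  rw [TensorProduct.smul_tmul_smul, map_smul, Units.val_mul]

end RaoDirectSumDatum

end HodgeCM.Literature.Theta

end
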